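import Literature.NumberTheory.K2Lit.SiegelHolomorphicSections
import HarnessLib

/-!
# Standard (`K`-finite, `K`-flat) families of Siegel sections on the doubled unitary group — the Iwasawa interface

Topic `NumberTheory/K2Lit` (Track B build stream 29; planner `hodgecm-mathlib-K2Liu-plan`; leaf **D1′** of the SIG TABLE
`Cruxes/HLiu418/Lines/K2_Liu_CurveThetaSigs.md`, put on the critical path of the tier-0 line's stub s5 by the LEAD's ruling «M-154n» R5:
the printed Siegel–Weil ∕ regularity theorems ([Tan1999], [KudlaRallis1994], [Ichino2004], [GanQiuTakeda2014 Thm 20 (i)]) are stated for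
STANDARD sections, so the line narrows its `∃`∕`∀` binders over section families to the class defined here).
Definitions and proved lemmas only: **no `sorry`, no named fact, no instance, no notation.**

* `IwasawaDatum` — an INTERFACE (data + axioms, no existence smuggled in): a compact subgroup `K ≤ H(𝔸)` of the doubled unitary group
  ★ `GRConstruction.HA` with the Iwasawa decomposition `H(𝔸) = P_Δ(𝔸)·K` (★ `GRConstruction.IsSiegelDelta`). That such a datum EXISTS
  (`K = ∏_v K_v`, `K_v` hyperspecial ∕ special maximal compact at finite `v`, `U(n) × U(n)`-type at archimedean `v`) is a separate CONSTRUCTION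
  statement (socket `sig_K2LiuIwasawaDatumNonempty` of the SIG TABLE), never a field of this structure.
* `rightTranslateSpan 𝒦 φ`, `IsKFinite 𝒦 φ` — the span of the right `K`-translates of `φ : H(𝔸) → ℂ` and its finite-dimensionality, with
  `zero ∕ add ∕ smul` closure.
* `IsStandardSectionFamily 𝒦 χ f` — a holomorphic family of Siegel sections (★ `IsHolomorphicSectionFamily`) that is `K`-finite for every `s`
  and FLAT: `f_s|_K` does not depend on `s`; the `ℂ`-submodule `standardSectionFamilies 𝒦 χ`; and the structure lemma
  `IsStandardSectionFamily.apply_delta_mul`: `f_s(p k) = χ_s(p) · f_{s₀}(k)` — a standard family is determined by `χ` and `f_{s₀}|_K`.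

References: V. Tan, Canad. J. Math. 51 (1999) §1 [Tan1999]; M. Harris, S. Kudla, W. J. Sweet, JAMS 9 (1996) (1.15)–(1.17) (WANT acq-04821)
[HarrisKudlaSweet1996]; S. Kudla, S. Rallis, Ann. of Math. 140 (1994) §1 (WANT acq-06809) [KudlaRallis1994]; Y. Liu, Invent. Math. 228 (2022)
Lem. B.10 p. 102 [Liu2021].
-/

noncomputable section

open NumberField

namespace Literature.NumberTheory.K2Lit.SiegelDoubled

open Literature.NumberTheory.Automorphic Literature.NumberTheory.GaloisRepresentations
open Literature.NumberTheory.GelbartRogawski1991 Literature.NumberTheory.GelbartRogawski1991.GRConstruction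

variable (L : Type) [Field L] [NumberField L] [IsCMField L]
variable {N M n : ℕ} (e : Fin N × Fin M ≃ Fin n)
  (dV : Fin N → L) (hdV : ∀ i, IsCMField.complexConj L (dV i) = dV i)
  (dW : Fin M → L) (hdW : ∀ i, IsCMField.complexConj L (dW i) = dW i)

/-! ## 1. The Iwasawa interface -/

/-- **An Iwasawa datum for `H(𝔸)`** (INTERFACE: data + axioms; existence is the separate construction statement
`sig_K2LiuIwasawaDatumNonempty`): a compact subgroup `K ≤ H(𝔸)` with `H(𝔸) = P_Δ(𝔸)·K`.
[cite: Tan1999, §1] [cite: HarrisKudlaSweet1996, (1.15)] -/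
structure IwasawaDatum where
  /-- the maximal compact subgroup `K = ∏_v K_v ≤ H(𝔸)` -/
  K : Subgroup (HA L e dV hdV dW hdW)
  /-- `K` is compact (for the adelic topology of `H(𝔸) ≤ GL_{2n}(𝔸_L)`) -/
  isCompact_K : IsCompact (K : Set (HA L e dV hdV dW hdW))
  /-- the Iwasawa decomposition `H(𝔸) = P_Δ(𝔸)·K` -/
  iwasawa : ∀ h : HA L e dV hdV dW hdW,
    ∃ p k : HA L e dV hdV dW hdW, IsSiegelDelta L e dV hdV dW hdW p ∧ k ∈ K ∧ h = p * k

variable {L e dV hdV dW hdW} in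
/-- `1 ∈ K`. [cite: Tan1999, §1] -/
theorem IwasawaDatum.one_mem (𝒦 : IwasawaDatum L e dV hdV dW hdW) : (1 : HA L e dV hdV dW hdW) ∈ 𝒦.K :=
  𝒦.K.one_mem

/-! ## 2. `K`-finiteness -/

variable {L e dV hdV dW hdW} in
/-- The `ℂ`-span of the right `K`-translates `h ↦ φ(h k)`, `k ∈ K`, of a function `φ : H(𝔸) → ℂ`. [cite: Tan1999, §1] -/
def rightTranslateSpan (𝒦 : IwasawaDatum L e dV hdV dW hdW) (φ : HA L e dV hdV dW hdW → ℂ) :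
    Submodule ℂ (HA L e dV hdV dW hdW → ℂ) :=
  Submodule.span ℂ (Set.range fun k : 𝒦.K => fun h : HA L e dV hdV dW hdW => φ (h * (k : HA L e dV hdV dW hdW)))

variable {L e dV hdV dW hdW} in
/-- Each right translate lies in the span. [cite: Tan1999, §1] -/
theorem rightTranslate_mem_rightTranslateSpan (𝒦 : IwasawaDatum L e dV hdV dW hdW) (φ : HA L e dV hdV dW hdW → ℂ)
    {k : HA L e dV hdV dW hdW} (hk : k ∈ 𝒦.K) :
    (fun h : HA L e dV hdV dW hdW => φ (h * k)) ∈ rightTranslateSpan 𝒦 φ :=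
  Submodule.subset_span ⟨⟨k, hk⟩, rfl⟩

variable {L e dV hdV dW hdW} in
/-- `φ` itself lies in the span of its right `K`-translates (`k = 1`). [cite: Tan1999, §1] -/
theorem self_mem_rightTranslateSpan (𝒦 : IwasawaDatum L e dV hdV dW hdW) (φ : HA L e dV hdV dW hdW → ℂ) :
    φ ∈ rightTranslateSpan 𝒦 φ := by
  have h := rightTranslate_mem_rightTranslateSpan 𝒦 φ 𝒦.one_mem
  simpa only [mul_one] using h

variable {L e dV hdV dW hdW} in
/-- **`K`-finiteness**: the right `K`-translates of `φ` span a finite-dimensional space. [cite: Tan1999, §1] [cite: HarrisKudlaSweet1996, (1.16)] -/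
def IsKFinite (𝒦 : IwasawaDatum L e dV hdV dW hdW) (φ : HA L e dV hdV dW hdW → ℂ) : Prop :=
  FiniteDimensional ℂ (rightTranslateSpan 𝒦 φ)

variable {L e dV hdV dW hdW} in
/-- The span of the translates of `0` is `⊥`. [cite: Tan1999, §1] -/
theorem rightTranslateSpan_zero (𝒦 : IwasawaDatum L e dV hdV dW hdW) :
    rightTranslateSpan 𝒦 (0 : HA L e dV hdV dW hdW → ℂ) = ⊥ :=
  Submodule.span_eq_bot.2 (by rintro _ ⟨k, rfl⟩; rfl)

variable {L e dV hdV dW hdW} in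
/-- `0` is `K`-finite. [cite: Tan1999, §1] -/
theorem isKFinite_zero (𝒦 : IwasawaDatum L e dV hdV dW hdW) : IsKFinite 𝒦 (0 : HA L e dV hdV dW hdW → ℂ) := by
  unfold IsKFinite
  rw [rightTranslateSpan_zero]
  infer_instance

variable {L e dV hdV dW hdW} in
/-- `K`-finite functions are closed under scalars. [cite: Tan1999, §1] -/
theorem IsKFinite.smul {𝒦 : IwasawaDatum L e dV hdV dW hdW} {φ : HA L e dV hdV dW hdW → ℂ} (a : ℂ)
    (hφ : IsKFinite 𝒦 φ) : IsKFinite 𝒦 (a • φ) := by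
  unfold IsKFinite at *
  haveI := hφ
  refine Submodule.finiteDimensional_of_le (S₁ := rightTranslateSpan 𝒦 (a • φ)) (S₂ := rightTranslateSpan 𝒦 φ)
    (Submodule.span_le.2 ?_)
  rintro _ ⟨k, rfl⟩
  exact Submodule.smul_mem _ a (rightTranslate_mem_rightTranslateSpan 𝒦 φ k.2)

variable {L e dV hdV dW hdW} in
/-- `K`-finite functions are closed under addition. [cite: Tan1999, §1] -/
theorem IsKFinite.add {𝒦 : IwasawaDatum L e dV hdV dW hdW} {φ ψ : HA L e dV hdV dW hdW → ℂ}
    (hφ : IsKFinite 𝒦 φ) (hψ : IsKFinite 𝒦 ψ) : IsKFinite 𝒦 (φ + ψ) := by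
  unfold IsKFinite at *
  haveI := hφ
  haveI := hψ
  refine Submodule.finiteDimensional_of_le (S₁ := rightTranslateSpan 𝒦 (φ + ψ))
    (S₂ := rightTranslateSpan 𝒦 φ ⊔ rightTranslateSpan 𝒦 ψ) (Submodule.span_le.2 ?_)
  rintro _ ⟨k, rfl⟩
  exact Submodule.add_mem_sup (rightTranslate_mem_rightTranslateSpan 𝒦 φ k.2) (rightTranslate_mem_rightTranslateSpan 𝒦 ψ k.2)

/-! ## 3. Standard families of Siegel sections -/

variable {L e dV hdV dW hdW} in
/-- **A standard family of Siegel sections** for the Iwasawa datum `𝒦`: a holomorphic family `f_s ∈ I(s, χ)` (★ `IsHolomorphicSectionFamily`)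
that is `K`-finite for every `s` and FLAT — `f_s|_K` is independent of `s`. [cite: Tan1999, §1] [cite: HarrisKudlaSweet1996, (1.15)–(1.17)]
[cite: KudlaRallis1994, §1] -/
def IsStandardSectionFamily (𝒦 : IwasawaDatum L e dV hdV dW hdW) (χ : HeckeCharacter L) (f : ℂ → HA L e dV hdV dW hdW → ℂ) : Prop :=
  IsHolomorphicSectionFamily L e dV hdV dW hdW χ f ∧ (∀ s : ℂ, IsKFinite 𝒦 (f s)) ∧
    ∀ k : HA L e dV hdV dW hdW, k ∈ 𝒦.K → ∀ s s' : ℂ, f s k = f s' k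

variable {L e dV hdV dW hdW} in
/-- The zero family is standard. [cite: Tan1999, §1] -/
theorem isStandardSectionFamily_zero (𝒦 : IwasawaDatum L e dV hdV dW hdW) (χ : HeckeCharacter L) :
    IsStandardSectionFamily 𝒦 χ (fun _ _ => 0) :=
  ⟨isHolomorphicSectionFamily_zero L e dV hdV dW hdW χ, fun _ => isKFinite_zero 𝒦, fun _ _ _ _ => rfl⟩

variable {L e dV hdV dW hdW} in
/-- Standard families are closed under addition. [cite: Tan1999, §1] -/
theorem IsStandardSectionFamily.add {𝒦 : IwasawaDatum L e dV hdV dW hdW} {χ : HeckeCharacter L}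
    {f g : ℂ → HA L e dV hdV dW hdW → ℂ} (hf : IsStandardSectionFamily 𝒦 χ f) (hg : IsStandardSectionFamily 𝒦 χ g) :
    IsStandardSectionFamily 𝒦 χ (f + g) :=
  ⟨hf.1.add hg.1, fun s => (hf.2.1 s).add (hg.2.1 s), fun k hk s s' => by
    simp only [Pi.add_apply, hf.2.2 k hk s s', hg.2.2 k hk s s']⟩

variable {L e dV hdV dW hdW} in
/-- Standard families are closed under scalars. [cite: Tan1999, §1] -/
theorem IsStandardSectionFamily.smul {𝒦 : IwasawaDatum L e dV hdV dW hdW} {χ : HeckeCharacter L}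
    {f : ℂ → HA L e dV hdV dW hdW → ℂ} (a : ℂ) (hf : IsStandardSectionFamily 𝒦 χ f) :
    IsStandardSectionFamily 𝒦 χ (a • f) :=
  ⟨hf.1.smul a, fun s => (hf.2.1 s).smul a, fun k hk s s' => by
    simp only [Pi.smul_apply, hf.2.2 k hk s s']⟩

variable {L e dV hdV dW hdW} in
/-- The `ℂ`-submodule of standard families of Siegel sections for `(𝒦, χ)`. [cite: Tan1999, §1] [cite: HarrisKudlaSweet1996, (1.17)] -/
def standardSectionFamilies (𝒦 : IwasawaDatum L e dV hdV dW hdW) (χ : HeckeCharacter L) :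
    Submodule ℂ (ℂ → HA L e dV hdV dW hdW → ℂ) where
  carrier := {f | IsStandardSectionFamily 𝒦 χ f}
  add_mem' hf hg := hf.add hg
  zero_mem' := isStandardSectionFamily_zero 𝒦 χ
  smul_mem' a _ hf := hf.smul a

variable {L e dV hdV dW hdW} in
/-- Membership in `standardSectionFamilies`. [cite: Tan1999, §1] -/
theorem mem_standardSectionFamilies_iff (𝒦 : IwasawaDatum L e dV hdV dW hdW) (χ : HeckeCharacter L)
    (f : ℂ → HA L e dV hdV dW hdW → ℂ) : f ∈ standardSectionFamilies 𝒦 χ ↔ IsStandardSectionFamily 𝒦 χ f :=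
  Iff.rfl

variable {L e dV hdV dW hdW} in
/-- A standard family is a holomorphic family (hence each `f_s` is a Siegel section and `s ↦ f_s(h)` is entire).
[cite: Tan1999, §1] -/
theorem IsStandardSectionFamily.isHolomorphicSectionFamily {𝒦 : IwasawaDatum L e dV hdV dW hdW} {χ : HeckeCharacter L}
    {f : ℂ → HA L e dV hdV dW hdW → ℂ} (hf : IsStandardSectionFamily 𝒦 χ f) :
    IsHolomorphicSectionFamily L e dV hdV dW hdW χ f :=
  hf.1

variable {L e dV hdV dW hdW} in
/-- **Structure lemma**: on `H(𝔸) = P_Δ(𝔸)·K` a standard family is determined by `χ` and its flat restriction to `K`: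
`f_s(p k) = χ_s(p) · f_{s₀}(k)` for `p ∈ P_Δ(𝔸)`, `k ∈ K`. [cite: Tan1999, §1] [cite: HarrisKudlaSweet1996, (1.17)] -/
theorem IsStandardSectionFamily.apply_delta_mul {𝒦 : IwasawaDatum L e dV hdV dW hdW} {χ : HeckeCharacter L}
    {f : ℂ → HA L e dV hdV dW hdW → ℂ} (hf : IsStandardSectionFamily 𝒦 χ f) (s s₀ : ℂ)
    {p k : HA L e dV hdV dW hdW} (hp : IsSiegelDelta L e dV hdV dW hdW p) (hk : k ∈ 𝒦.K) :
    f s (p * k) = siegelDeltaCharacter L e dV hdV dW hdW χ s p * f s₀ k := by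
  rw [(hf.1.1 s) p hp k, hf.2.2 k hk s s₀]

variable {L e dV hdV dW hdW} in
/-- Consequently a standard family vanishing on `K` at one parameter `s₀` vanishes identically. [cite: Tan1999, §1] -/
theorem IsStandardSectionFamily.eq_zero_of_restrict_eq_zero {𝒦 : IwasawaDatum L e dV hdV dW hdW} {χ : HeckeCharacter L}
    {f : ℂ → HA L e dV hdV dW hdW → ℂ} (hf : IsStandardSectionFamily 𝒦 χ f) (s₀ : ℂ)
    (h0 : ∀ k : HA L e dV hdV dW hdW, k ∈ 𝒦.K → f s₀ k = 0) (s : ℂ) (h : HA L e dV hdV dW hdW) : f s h = 0 := by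
  obtain ⟨p, k, hp, hk, rfl⟩ := 𝒦.iwasawa h
  rw [hf.apply_delta_mul s s₀ hp hk, h0 k hk, mul_zero]

end Literature.NumberTheory.K2Lit.SiegelDoubled
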